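import Literature.Computability.Complexity.ProofComplexityProofs
import Literature.Computability.Complexity.TautCertificates
import Literature.Computability.Complexity.ListFoldChecks
import Literature.Barriers.QuantumAdvantage.TQBFCodewords
import HarnessLib

/-!
# EF proof search under `P = NP` (route EfNotPOptimal, item `EFProofSearchOfCollapse`): definitions

Definitions file (0/5) for the route item `EFProofSearchOfCollapse` (stmt-PneNP-18943, glue S1 of
route EfNotPOptimal: if `P = NP`, a Frege rule list `F` with polynomially bounded extended Frege has
a polynomial-time function producing EF proofs of all tautologies). The proof finder SEARCHES
(search-to-decision, Arora–Barak Thm. 2.18, tree: `exists_searchFn_of_NP_subset_P`) for a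
certificate in a normal form whose validity is CHECKABLE by the tree's `FP` bricks, and re-encodes
it. All objects are plain (data) definitions; their properties are proved in the sibling files
`…NormalForm`, `…Renaming`, `…Bricks`, `…Checker` and the closer `EfNotPOptimalEFProofSearchOfCollapse`.

* Mathematics of the normal form: `xvar L j` (the canonical extension variable with binary numeral
  `1^{L+j+1}`), `extLine L (j, ψ) = (xvar L j ↔ ψ)`, the renaming substitution `tauOf`, the unit
  table `unitTable` (with it the Cook–Reckhow translation `FregeTransl.translForms` COUNTS inferred
  lines).
* String bricks (total functions `List Bool → List Bool`, compositions of tree bricks):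
  `ucountFn`, `lastItemFn`, `mapStep`/`mapCtxFn` (map with context over a coded list), `boundFn`,
  `payLtFn`, `vbFn` (variable-bound test via the payload transducer `payT`), `xvCodeFn`, `extCodeFn`,
  `extHdrFn`, `mkExtFn` (builder of the code word of a canonical extension line).
* The checker of certificates `y = ⟨A, B⟩` for a code word `x` (`A` = extension items
  `⟨1ʲ, encode ψ_j⟩`, `B` = code words of lines): readers `xAFn`/`xBFn`, tests `c2Fn` (items carry
  formula code words with short variables), `c3Fn` (indices increase), `c4Fn` (lines are code words),
  `c5Fn` (every line inferred, by counting with `translFn unitTable`), `c6Fn` (last line is `x`),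
  `chkFn`; the list codes `elFn`, `plFn`, counters `cntAFn`, `cntBFn`, `fullFn`, `eOnlyFn`.
* Decoding and packaging: `decodeForm`, `itemsOf`, `linesOf`, `extractProof`, `itemStr`, `certOf`
  (the certificate of a normal form), `finderFn` (search + check + re-encode), `proofFn` (the EF proof
  it computes).

References: S. A. Cook, R. A. Reckhow, *The relative efficiency of propositional proof systems*,
JSL 44 (1979), §1 (Def. 1.5: the class `𝓛` of polynomial-time functions), §2 (Lemma 2.5, Thm. 2.3),
§4 (Def. 4.1: the extension rule); J. Krajíček, *Bounded arithmetic, propositional logic, and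
complexity theory* (CUP 1995), Def. 4.5.2; S. Arora, B. Barak, *Computational Complexity* (CUP 2009),
Thm. 2.18 (decision versus search).
-/

set_option linter.dupNamespace false

namespace Summit.PneNP.PneNP.Theorems.EFProofSearch

open _root_.Computability Literature.Computability.Complexity Literature.Computability.MetaComplexity
open Literature.Barriers.QuantumAdvantage.TQBFEval (varOcc)
open Brick FregeTransl
open Literature.Barriers.QuantumAdvantage.TQBFEval (cwFn payT)

/-- The `j`-th canonical extension variable above level `L`: the natural number whose binary
numeral (`encodeNat`) is `1^{L+j+1}`. -/
def xvar (L j : ℕ) : ℕ := decodeNat (List.replicate (L + j + 1) true)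

/-- The canonical extension line with index `j` and body `ψ`: `xvar L j ↔ ψ`. -/
def extLine (L : ℕ) (it : ℕ × PropForm ℕ) : PropForm ℕ :=
  PropForm.biimp (.var (xvar L it.1)) it.2

/-- The renaming substitution of the normal form: variables of `φ` are kept, a variable carrying
the index `j` (an extension variable) goes to `xvar L j`, every other variable to `⊤`. -/
def tauOf (φ : PropForm ℕ) (L : ℕ) (ext : ℕ → Option ℕ) (v : ℕ) : PropForm ℕ :=
  if v ∈ φ.vars then .var v else
    match ext v with
    | some j => .var (xvar L j)
    | none => .const true

/-- The unit table: every rule is "derived" by the single line `⊤`. With it, the Cook–Reckhow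
translation `translForms` emits exactly one line per inferred line and nothing for the others, so
its length COUNTS the inferred lines. -/
def unitTable : FregeRule → List (PropForm ℕ) := fun _ => [.const true]

/-- `ucountFn ⟨x, L⟩ = 1^{#items of L}`: the unary number of items of a coded list (a fold adding one
`1` per item). -/
noncomputable def ucountFn : List Bool → List Bool :=
  foldFn (List.cons true ∘ sndPow 1) fun _ => []

/-- `lastItemFn ⟨x, L⟩` = the last item of `L` (`ε` if there is none). -/
noncomputable def lastItemFn : List Bool → List Bool :=
  foldFn (nthF 1) fun _ => []

/-- The step of the context map: append the code of `g ⟨x, item⟩` to the accumulated list code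
(step argument `⟨⟨x, L⟩, ⟨item, acc⟩⟩`). -/
noncomputable def mapStep (g : List Bool → List Bool) : List Bool → List Bool :=
  fun v => sndPow 1 v ++ fanoutFn (g ∘ fanoutFn (fstF ∘ nthF 0) (nthF 1)) (fun _ => []) v

/-- **The context map** `mapCtxFn g ⟨x, L⟩ = encList [g ⟨x, a₀⟩, g ⟨x, a₁⟩, …]` over the items
`aᵢ` of `L`. -/
noncomputable def mapCtxFn (g : List Bool → List Bool) : List Bool → List Bool :=
  foldFn (mapStep g) fun _ => []

/-- The bound string of an item `⟨u, w⟩` in context `x`: `1^{|x| + |u| + 1}` (argument `⟨x, ⟨u, w⟩⟩`). -/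
noncomputable def boundFn : List Bool → List Bool :=
  fun v => true :: (onesFn (fstF v) ++ onesFn (fstF (sndF v)))

/-- The per-payload test `⟨bound, a⟩ ↦ [|a| < |bound|]`. -/
noncomputable def payLtFn : List Bool → List Bool := ltLenF ∘ fanoutFn sndF fstF

/-- **The variable-bound test** on `⟨x, ⟨u, ⟨h, c⟩⟩⟩`: every variable payload of the prefix code `c`
is shorter than `|x| + |u| + 1`. -/
noncomputable def vbFn : List Bool → List Bool :=
  allFn payLtFn ∘ fanoutFn boundFn (payT.eval ∘ sndF ∘ sndF ∘ sndF)

/-- The code of the canonical extension variable of an item `⟨u, w⟩` in context `x`: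
`00 · ⟨1^{|x|+|u|+1}, ε⟩` (argument `⟨x, ⟨u, w⟩⟩`). -/
noncomputable def xvCodeFn : List Bool → List Bool :=
  List.cons false ∘ List.cons false ∘ fanoutFn boundFn (fun _ => [])

/-- The prefix code of the extension line built from `⟨x, ⟨u, ⟨h, c⟩⟩⟩`:
`code ((V ↔ ψ)) = 110 · (111 · 10 · V · c) · (111 · V · 10 · c)` with `V` the code of the extension
variable and `c` the code of the body. -/
noncomputable def extCodeFn : List Bool → List Bool :=
  fun v => [true, true, false] ++ (([true, true, true] ++ (([true, false] ++ xvCodeFn v) ++ sndF (sndF (sndF v)))) ++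
    ([true, true, true] ++ (xvCodeFn v ++ ([true, false] ++ sndF (sndF (sndF v))))))

/-- The unary size header of the extension line: `1^{2s + 7}` from the header `1^s` of the body. -/
noncomputable def extHdrFn : List Bool → List Bool :=
  fun v => fstF (sndF (sndF v)) ++ (fstF (sndF (sndF v)) ++ List.replicate 7 true)

/-- **The extension-line builder** `mkExtFn ⟨x, ⟨u, encode ψ⟩⟩ = encode (xvar |x| |u| ↔ ψ)`. -/
noncomputable def mkExtFn : List Bool → List Bool := fanoutFn extHdrFn extCodeFn

/-- `⟨x, y⟩ ↦ ⟨x, encList (items of fstF y)⟩`: the context with the RE-ENCODED list of extension items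
(so that every list brick downstream reads a genuine list code). -/
noncomputable def xAFn : List Bool → List Bool :=
  fanoutFn fstF (mapCtxFn sndF ∘ fanoutFn fstF (fstF ∘ sndF))

/-- `⟨x, y⟩ ↦ ⟨x, encList (items of sndF y)⟩`: the context with the re-encoded list of lines. -/
noncomputable def xBFn : List Bool → List Bool :=
  fanoutFn fstF (mapCtxFn sndF ∘ fanoutFn fstF (sndF ∘ sndF))

/-- The item test on `⟨x, ⟨u, w⟩⟩`: `w` is a formula code word and its variables are short. -/
noncomputable def eItemFn : List Bool → List Bool := andFn (cwFn ∘ sndF ∘ sndF) vbFn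

/-- Test C2: all extension items pass the item test. -/
noncomputable def c2Fn : List Bool → List Bool := allFn eItemFn ∘ xAFn

/-- The index comparison on `⟨x, ⟨a, b⟩⟩`: `[|fstF a| < |fstF b|]`. -/
noncomputable def idxLtFn : List Bool → List Bool :=
  ltLenF ∘ fanoutFn (fstF ∘ fstF ∘ sndF) (fstF ∘ sndF ∘ sndF)

/-- Test C3: the indices of consecutive extension items increase. -/
noncomputable def c3Fn : List Bool → List Bool := chainFn idxLtFn ∘ xAFn

/-- Test C4: all lines are formula code words. -/
noncomputable def c4Fn : List Bool → List Bool := allFn (cwFn ∘ sndF) ∘ xBFn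

/-- The list code of the extension lines. -/
noncomputable def elFn : List Bool → List Bool := mapCtxFn mkExtFn ∘ xAFn

/-- The list code of the (re-encoded) lines. -/
noncomputable def plFn : List Bool → List Bool := sndF ∘ xBFn

/-- The unary number of extension items. -/
noncomputable def cntAFn : List Bool → List Bool := ucountFn ∘ xAFn

/-- The unary number of lines. -/
noncomputable def cntBFn : List Bool → List Bool := ucountFn ∘ xBFn

/-- The `listBool` code of the whole candidate proof: extension lines followed by the lines. -/
noncomputable def fullFn : List Bool → List Bool :=
  fanoutFn (fun z => cntAFn z ++ cntBFn z) (fun z => elFn z ++ plFn z)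

/-- The `listBool` code of the extension lines alone. -/
noncomputable def eOnlyFn : List Bool → List Bool := fanoutFn cntAFn elFn

/-- Test C5 (all lines inferred, by COUNTING): the unit-table Cook–Reckhow translation of the whole
candidate proof is longer than that of the extension lines alone by exactly the number of lines. -/
noncomputable def c5Fn (F : FregeSystem) : List Bool → List Bool :=
  eqPairFn ∘ fanoutFn (fstF ∘ translFn unitTable F.rules ∘ fullFn)
    (fun z => (fstF ∘ translFn unitTable F.rules ∘ eOnlyFn) z ++ cntBFn z)

/-- Test C6: the last line is the input formula. -/
noncomputable def c6Fn : List Bool → List Bool := eqPairFn ∘ fanoutFn (lastItemFn ∘ xBFn) fstF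

/-- **The certificate checker** of the Frege rule list `F`. -/
noncomputable def chkFn (F : FregeSystem) : List Bool → List Bool :=
  andFn c2Fn (andFn c3Fn (andFn c4Fn (andFn (c5Fn F) c6Fn)))

/-- The total decoder of formula code words (non-code-words go to `⊤`). -/
noncomputable def decodeForm (w : List Bool) : PropForm ℕ := (encodingPropForm.decode w).getD (.const true)

/-- The (index, body) pairs read off the extension items of a certificate. -/
noncomputable def itemsOf (y : List Bool) : List (ℕ × PropForm ℕ) :=
  (decNil (fstF y)).map fun a => ((fstF a).length, decodeForm (sndF a))

/-- The lines read off a certificate. -/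
noncomputable def linesOf (y : List Bool) : List (PropForm ℕ) := (decNil (sndF y)).map decodeForm

/-- **The candidate proof extracted from a certificate** `y` for the formula code word `x`: the
canonical extension lines of the items, then the lines. -/
noncomputable def extractProof (x y : List Bool) : List (PropForm ℕ) :=
  (itemsOf y).map (extLine x.length) ++ linesOf y

/-- The string of one extension item `(j, ψ)`: `⟨1ʲ, encode ψ⟩`. -/
def itemStr (it : ℕ × PropForm ℕ) : List Bool :=
  boolPair (List.replicate it.1 true) (encodingPropForm.encode it.2)

/-- **The certificate of a normal form**: `⟨encList of the item strings, encList of the line codes⟩`. -/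
def certOf (items : List (ℕ × PropForm ℕ)) (P : List (PropForm ℕ)) : List Bool :=
  boolPair (encList (items.map itemStr)) (encList (P.map encodingPropForm.encode))

/-- The proof finder on strings, for a search function `g`: pair the input with `g`'s answer, check
it, and output the code of the extracted proof (or of the empty sequence if the check fails). -/
noncomputable def finderFn (F : FregeSystem) (g : List Bool → List Bool) : List Bool → List Bool :=
  iteFn (chkFn F ∘ fanoutFn id g) (fullFn ∘ fanoutFn id g) (fun _ => encodingPropForm.listBool.encode [])

/-- The proof-valued function computed by the finder: the extracted proof if the check passes,
else the empty sequence. -/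
noncomputable def proofFn (F : FregeSystem) (g : List Bool → List Bool) (φ : PropForm ℕ) : List (PropForm ℕ) :=
  if chkFn F (boolPair (encodingPropForm.encode φ) (g (encodingPropForm.encode φ))) = [true] then
    extractProof (encodingPropForm.encode φ) (g (encodingPropForm.encode φ)) else []

end Summit.PneNP.PneNP.Theorems.EFProofSearch
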